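import Summits.BirchSwinnertonDyer.BirchSwinnertonDyer.Theorems.ByReductionTypeAtTwoSupersingularFlatNoFiniteSubmoduleOfClassical
import Summits.BirchSwinnertonDyer.BirchSwinnertonDyer.Theorems.PublishedInputsGreenbergRelaxedCountHolds
import Literature.NumberTheory.EllipticCurves.SelmerCorankControlRatProofs
import Literature.NumberTheory.EllipticCurves.BSDConductorProofs
import HarnessLib

/-!
# Route `ByReductionTypeAtTwo` (rung K4), crux `SupersingularRankZeroAtTwo` (item stmt-BirchSwinnertonDyer-19097), line
# `odd_blind_package`, slot 4 NF♭: **the rank input (hB) «`rank_Λ X(E/ℚ_∞) ≥ 1` at supersingular `2`» of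
# `OddBlindNF.flatNoFiniteSubmoduleAtTwo_of_classical` DISCHARGED — Greenberg's Thm. 1.7 (Schneider) is a tree theorem —
# so NF♭ ⟸ classical NF at supersingular `2` + «`ker(X ↠ X♭)` is cyclic» (two displayed inputs)
# (cell `bsd-2adic`, LEAD ss-1 GEN 23; `--supports 19097`, helper)

HONEST FRAMING: THEOREMS ONLY (no definition, no named fact, no `sorry`, no instance).  The hypothesis (hB) of
`flatNoFiniteSubmoduleAtTwo_of_classical` (p822368) is PROVED: for `E/ℚ` good supersingular at `2` and the cyclotomic data, every
classical dual Selmer datum `S : W.SelmerDualData κ γ` has a non-torsion element — this is Greenberg LNM 1716 Thm. 1.7 (supersingular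
case, due to P. Schneider), an UNCONDITIONAL theorem of the tree for every number field
(`InputsGreenbergRelaxedCount.not_isTorsion_of_supersingular`, seat `bsd-inputs-k4-p1`: (I1) relaxed Poitou–Tate count over the layers,
now hypothesis-free since `poitouTate_selmerStructure_duality` holds, + (I2) Coates–Greenberg), bridged to the route predicate
`GoodSS W 2 = HasGoodReductionAtPrime 2 ∧ 2 ∣ a₂` at the place of `ℚ` over `2` (`hasGoodReductionAt_of_hasGoodReductionAtPrime`,
`hasUnitRootAt_iff_not_dvd_frobeniusTrace`).  Hence slot 4 of the line is REDUCED to TWO displayed inputs: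
(hA) classical NF at supersingular `2` and (hC) «`ker(X ↠ X♭) = Λ ∙ x₀`».  Neither is asserted; 19097 stays OPEN; nothing is
booked; BSD is proved for no curve by any of this.  bears_on: K4 (19097).

* `exists_nonTorsion_classical_of_goodSS_two` — (hB) VERBATIM as displayed in p822368: `∃ y : S.X, ∀ f, f • y = 0 → f = 0`.
* ★★ `flatNoFiniteSubmoduleAtTwo_of_classical_of_kernelCyclic (hA) (hC)` — the body of `OddBlindPackage.FlatNoFiniteSubmoduleAtTwo`
  VERBATIM from the two remaining inputs.

References: [GreenbergLNM1716] Thm. 1.7 (pp. 61–62), pp. 104–105; [KitajimaOtsuki2018] Prop. 4.6, 4.7, Thm. 4.8 (arXiv:1607.03612 p. 19);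
[CoatesGreenberg1996] Cor. 3.2.
-/

set_option autoImplicit false
-- the Theorems namespace of this sub repeats the summit name by design (D-0017 nested layout)
set_option linter.dupNamespace false

noncomputable section

open scoped Classical NumberField
open NumberField IsDedekindDomain WeierstrassCurve Literature.NumberTheory.EllipticCurves
  Literature.NumberTheory.EllipticCurves.Sprung2017 Literature.NumberTheory.EllipticCurves.Sprung2012
  Literature.NumberTheory.EllipticCurves.Rank1Residual Literature.NumberTheory.EllipticCurves.Rank1Residual.Typed
  Literature.NumberTheory.EllipticCurves.Kobayashi2003 Literature.NumberTheory.EllipticCurves.IwasawaDual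
  Literature.NumberTheory.GaloisRepresentations
  ZpExtension Summit.BirchSwinnertonDyer.Rank1Residual Summit.BirchSwinnertonDyer.Rank1Residual.Supersingular

namespace Summit.BirchSwinnertonDyer.BirchSwinnertonDyer.Theorems

namespace OddBlindNF

/-! ### §1 (hB) discharged: Greenberg's Thm. 1.7 at the place of `ℚ` over `2` -/

/-- **(hB) «`rank_Λ X(E/ℚ_∞) ≥ 1` at good supersingular `2`» — PROVED.**  For `E = W/ℚ` elliptic, globally minimal, good supersingular
at `2` (`GoodSS W 2`), `κ` cyclotomic with topological generator `γ` (the cyclotomic-variable binder is carried, unused), every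
classical dual Selmer datum `S : W.SelmerDualData κ γ` (f.g.) has an element `y` with `f • y = 0 → f = 0` — i.e. `X(E/ℚ_∞)` is not
`Λ`-torsion (Greenberg Thm. 1.7, tree theorem `InputsGreenbergRelaxedCount.not_isTorsion_of_supersingular` at the place
`(primesEquiv)⁻¹ 2`, where `GoodSS` gives good reduction and `2 ∣ a₂` the failure of the unit-root condition), read through
«`Λ = ℤ₂⟦T⟧` is a domain: a non-zero `f` is a non-zero-divisor».
[cite: GreenbergLNM1716, Thm. 1.7 (pp. 61–62)] [cite: CoatesGreenberg1996, Cor. 3.2] -/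
theorem exists_nonTorsion_classical_of_goodSS_two :
    ∀ (W : WeierstrassCurve ℚ) [W.IsElliptic] [W.IsGloballyMinimal], GoodSS W 2 →
      ∀ (κ : ZpExtension ℚ 2) (γ : Field.absoluteGaloisGroup ℚ),
        κ.IsCyclotomic → κ.IsTopGenerator γ → IsCyclotomicVariable 2 γ →
      ∀ (S : W.SelmerDualData κ γ) [Module.Finite (IwasawaAlgebra 2) S.X],
        ∃ y : S.X, ∀ f : IwasawaAlgebra 2, f • y = 0 → f = 0 := by
  intro W _ _ hss κ γ hκ hγ _ S _
  have hp : (2 : ℕ).Prime := Fact.out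
  -- the place of `ℚ` over `2` is good supersingular
  have hv2 : ((2 : ℕ) : 𝓞 ℚ) ∈ ((Rat.HeightOneSpectrum.primesEquiv (R := 𝓞 ℚ)).symm ⟨2, hp⟩).asIdeal :=
    (natCast_mem_asIdeal_iff_eq_primesEquiv_symm _ hp).mpr rfl
  have hgood : W.HasGoodReductionAt ((Rat.HeightOneSpectrum.primesEquiv (R := 𝓞 ℚ)).symm ⟨2, hp⟩) :=
    W.hasGoodReductionAt_of_hasGoodReductionAtPrime _ hv2 hss.1
  have hnu : ¬ W.HasUnitRootAt ((Rat.HeightOneSpectrum.primesEquiv (R := 𝓞 ℚ)).symm ⟨2, hp⟩) := by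
    rw [W.hasUnitRootAt_iff_not_dvd_frobeniusTrace _ hp hv2, not_not]
    exact hss.2
  -- Thm. 1.7: `X(E/ℚ_∞)` is not `Λ`-torsion
  have hNT : ¬ S.IsTorsion :=
    InputsGreenbergRelaxedCount.not_isTorsion_of_supersingular S hκ hγ hv2 hgood hnu
  -- read off a non-torsion element
  by_contra hcon
  push Not at hcon
  apply hNT
  intro x
  obtain ⟨f, hf, hf0⟩ := hcon x
  exact ⟨⟨f, mem_nonZeroDivisors_of_ne_zero hf0⟩, hf⟩

/-! ### §2 ★★ NF♭ from the two remaining inputs -/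

/-- ★★ **NF♭ ⟸ (hA) classical NF at supersingular `2` + (hC) «`ker(X ↠ X♭)` is CYCLIC».**  Conclusion = the body of
`OddBlindPackage.FlatNoFiniteSubmoduleAtTwo` VERBATIM; = `flatNoFiniteSubmoduleAtTwo_of_classical hA exists_nonTorsion_classical_of_goodSS_two hC`.
(hA): every f.g. classical dual `X(E/ℚ_∞) = S.X` has no non-zero finite `Λ`-submodule for `E` good supersingular at `2` (Kitajima–Otsuki
Thm. 4.5 = Matsuno 2003 Prop. 4.1 shape: Cassels–Tate on the layers + stabilisation of divisible parts + `E(ℚ)[2] = 0`; NOT asserted).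
(hC): for every ♭ datum `D` (f.g., torsion) and every `Λ`-linear `π : S.X → D.X` over `Sel♭ ≤ Sel`, `ker π = Λ ∙ x₀` for some `x₀`
(Kitajima–Otsuki (4.2) + Prop. 3.32 for `♭` at `2`: the annihilator of `Sel♭_∞` is the image of the CYCLIC `Ker Col♭`; NOT asserted).
[cite: KitajimaOtsuki2018, Prop. 4.6, 4.7, Thm. 4.8 (arXiv:1607.03612 p. 19)] [cite: GreenbergLNM1716, Thm. 1.7 and pp. 104–105] -/
theorem flatNoFiniteSubmoduleAtTwo_of_classical_of_kernelCyclic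
    (hA : ∀ (W : WeierstrassCurve ℚ) [W.IsElliptic] [W.IsGloballyMinimal], GoodSS W 2 →
      ∀ (κ : ZpExtension ℚ 2) (γ : Field.absoluteGaloisGroup ℚ),
        κ.IsCyclotomic → κ.IsTopGenerator γ → IsCyclotomicVariable 2 γ →
      ∀ (S : W.SelmerDualData κ γ) [Module.Finite (IwasawaAlgebra 2) S.X],
        ∀ N : Submodule (IwasawaAlgebra 2) S.X, Finite N → N = ⊥)
    (hC : ∀ (W : WeierstrassCurve ℚ) [W.IsElliptic] [W.IsGloballyMinimal], GoodSS W 2 →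
      ∀ (κ : ZpExtension ℚ 2) (γ : Field.absoluteGaloisGroup ℚ),
        κ.IsCyclotomic → κ.IsTopGenerator γ → IsCyclotomicVariable 2 γ →
      ∀ (v : HeightOneSpectrum (𝓞 ℚ)), (2 : 𝓞 ℚ) ∈ v.asIdeal →
      ∀ (g : Field.absoluteGaloisGroup (v.adicCompletion ℚ)) (c : ℕ → localPoints W (v.adicCompletion ℚ)),
        κ.IsTopGenerator (resGalOfEmb (closureEmb (K := ℚ) (v.adicCompletion ℚ)) g) →
        (∀ n, c n ∈ localLayerPointsOfEmb κ (closureEmb (K := ℚ) (v.adicCompletion ℚ)) W n) →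
        (∀ n, 1 ≤ n → localTraceOfEmb κ (closureEmb (K := ℚ) (v.adicCompletion ℚ)) W n (n + 1)
          (c (n + 1)) = W.frobeniusTrace 2 • c n - c (n - 1)) →
        (∀ z₀ : localLayerPointsOfEmb κ (closureEmb (K := ℚ) (v.adicCompletion ℚ)) W 0 →+ ℤ_[2],
          evalOn W (localLayerPointsOfEmb κ (closureEmb (K := ℚ) (v.adicCompletion ℚ)) W 0) z₀ (c 0) = 0 →
            z₀ = 0) →
        (∀ a : ℤ_[2],
          (∃ z₀ : localLayerPointsOfEmb κ (closureEmb (K := ℚ) (v.adicCompletion ℚ)) W 0 →+ ℤ_[2],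
            evalOn W (localLayerPointsOfEmb κ (closureEmb (K := ℚ) (v.adicCompletion ℚ)) W 0) z₀ (c 0) = 2 * a) →
          ∃ y : localLayerPointsOfEmb κ (closureEmb (K := ℚ) (v.adicCompletion ℚ)) W 0 →+ ℤ_[2],
            evalOn W (localLayerPointsOfEmb κ (closureEmb (K := ℚ) (v.adicCompletion ℚ)) W 0) y (c 0) = a) →
      ∀ (D : SharpFlatSelmerDualData W κ γ (closureEmb (K := ℚ) (v.adicCompletion ℚ))
          (W.frobeniusTrace 2) g c .flat) [Module.Finite (IwasawaAlgebra 2) D.X],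
        Module.IsTorsion (IwasawaAlgebra 2) D.X →
      ∀ (S : W.SelmerDualData κ γ) [Module.Finite (IwasawaAlgebra 2) S.X]
        (π : S.X →ₗ[IwasawaAlgebra 2] D.X),
        (∀ (x : S.X) (s : sharpFlatSelmerInfty W κ (closureEmb (K := ℚ) (v.adicCompletion ℚ)) (W.frobeniusTrace 2) g c .flat),
          D.toDual (π x) s = S.toDual x (AddSubgroup.inclusion
            (sharpFlatSelmerInfty_le_selmerInfty W κ (closureEmb (K := ℚ) (v.adicCompletion ℚ)) (W.frobeniusTrace 2) g c .flat) s)) →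
        ∃ x₀ : S.X, LinearMap.ker π = Submodule.span (IwasawaAlgebra 2) {x₀}) :
    ∀ (W : WeierstrassCurve ℚ) [W.IsElliptic] [W.IsGloballyMinimal], GoodSS W 2 →
    ∀ (κ : ZpExtension ℚ 2) (γ : Field.absoluteGaloisGroup ℚ),
      κ.IsCyclotomic → κ.IsTopGenerator γ → IsCyclotomicVariable 2 γ →
    ∀ (v : HeightOneSpectrum (𝓞 ℚ)), (2 : 𝓞 ℚ) ∈ v.asIdeal →
    ∀ (g : Field.absoluteGaloisGroup (v.adicCompletion ℚ)) (c : ℕ → localPoints W (v.adicCompletion ℚ)),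
      κ.IsTopGenerator (resGalOfEmb (closureEmb (K := ℚ) (v.adicCompletion ℚ)) g) →
      (∀ n, c n ∈ localLayerPointsOfEmb κ (closureEmb (K := ℚ) (v.adicCompletion ℚ)) W n) →
      (∀ n, 1 ≤ n → localTraceOfEmb κ (closureEmb (K := ℚ) (v.adicCompletion ℚ)) W n (n + 1)
        (c (n + 1)) = W.frobeniusTrace 2 • c n - c (n - 1)) →
      (∀ z₀ : localLayerPointsOfEmb κ (closureEmb (K := ℚ) (v.adicCompletion ℚ)) W 0 →+ ℤ_[2],
        evalOn W (localLayerPointsOfEmb κ (closureEmb (K := ℚ) (v.adicCompletion ℚ)) W 0) z₀ (c 0) = 0 →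
          z₀ = 0) →
      (∀ a : ℤ_[2],
        (∃ z₀ : localLayerPointsOfEmb κ (closureEmb (K := ℚ) (v.adicCompletion ℚ)) W 0 →+ ℤ_[2],
          evalOn W (localLayerPointsOfEmb κ (closureEmb (K := ℚ) (v.adicCompletion ℚ)) W 0) z₀ (c 0) = 2 * a) →
        ∃ y : localLayerPointsOfEmb κ (closureEmb (K := ℚ) (v.adicCompletion ℚ)) W 0 →+ ℤ_[2],
          evalOn W (localLayerPointsOfEmb κ (closureEmb (K := ℚ) (v.adicCompletion ℚ)) W 0) y (c 0) = a) →
    ∀ (D : SharpFlatSelmerDualData W κ γ (closureEmb (K := ℚ) (v.adicCompletion ℚ))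
        (W.frobeniusTrace 2) g c .flat) [Module.Finite (IwasawaAlgebra 2) D.X],
      Module.IsTorsion (IwasawaAlgebra 2) D.X →
      ∀ N : Submodule (IwasawaAlgebra 2) D.X, Finite N → N = ⊥ :=
  flatNoFiniteSubmoduleAtTwo_of_classical hA exists_nonTorsion_classical_of_goodSS_two hC

end OddBlindNF

end Summit.BirchSwinnertonDyer.BirchSwinnertonDyer.Theorems

end
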